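import Literature.NumberTheory.LFunctions.DeBruijnNewmanProofs
import Literature.NumberTheory.LFunctions.XiMoments
import Literature.NumberTheory.LFunctions.XiTiltedPotential
import Literature.NumberTheory.LFunctions.DeBruijnPhiLogDerivEnvelope
import HarnessLib

/-!
# The Gauss-tilted Pólya–de Bruijn weight `ω_{n,x}(u) = Φ(u) uⁿ e^{xu²/2}`: integrability, potential, mode

The Jensen polynomial `J^{d,n}_ξ(-x)` is an average of the Szegő normal form of `L_d^{(n-1/2)}` against the
law `∝ ω_{n,x}(u) du` on `(0, ∞)`, `ω_{n,x}(u) = Φ(u) uⁿ e^{xu²/2}` (`JensenXiLaguerreIntegral.lean`). This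
file is the dictionary of that law:

* `xiGaussWeight` and its integrability against polynomials (from the tree's dominating function
  `deBruijnHBound` of de Bruijn's `H_t`), positivity of `∫₀^∞ ω`;
* the potential `W(u) = -n log u - log Φ(u) - xu²/2 = xiPotential n u - xu²/2` (`xiGaussPotential`), its
  derivatives `W′ = W_n′ - xu`, `W″ = W_n″ - x = n/u² + V(u) - x` in `HasDerivAt` form, and
  `W″(u) > 16πe^{4u} + n/u² - x` (Coffey–Csordas' quantitative log-concavity of `Φ`, tree);
* the MODE PARAMETRISATION `y(a) := aL(a) - n`, `x(a) := y(a)/a²` (`L = -Φ′/Φ`), for which `W′(a) = 0`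
  (`xiGaussPotentialDeriv_mode`), and the envelopes at the mode
  `4(n+y)/a + 36 ≤ 16πe^{4a} ≤ 4(n+y)/a + 36.02` (`a ≥ 3/2` for the upper one) from the tree's
  envelopes `4πe^{4u} - 9.005 ≤ L(u) ≤ 4πe^{4u} - 9`.

## References
* [GORZPNAS2019] Griffin–Ono–Rolen–Zagier, PNAS 116 (2019), Thm. 7 (the tilted kernel `u^kΦ(u)`).
* [CoffeyCsordas2013] Coffey–Csordas, Math. Comp. 82 (2013), Thm. 2.4, Prop. 2.1.
-/

noncomputable section

open MeasureTheory Set Real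
open scoped Topology Nat

namespace Literature.NumberTheory.LFunctions

/-! ### The Gauss-tilted weight and its integrability -/

/-- The Gauss-tilted Pólya–de Bruijn weight `ω_{n,x}(u) = Φ(u) · uⁿ · e^{x u²/2}` (the tilted kernel
`u^{2n}Φ(u)` of GORZ Thm. 7 after splitting off the Laguerre half-weight `e^{y/2} y^{-(α+1)/2}`,
`y = xu²`, `α = n - 1/2`). [cite: GORZPNAS2019, Thm. 7] -/
def xiGaussWeight (n : ℕ) (x u : ℝ) : ℝ :=
  deBruijnPhi u * u ^ n * Real.exp (x * u ^ 2 / 2)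

/-- `ω_{n,x}(u) > 0` for `u > 0`. [cite: GORZPNAS2019, Thm. 7] -/
theorem xiGaussWeight_pos (n : ℕ) (x : ℝ) {u : ℝ} (hu : 0 < u) : 0 < xiGaussWeight n x u := by
  unfold xiGaussWeight
  exact mul_pos (mul_pos (deBruijnPhi_pos_holds u) (pow_pos hu n)) (Real.exp_pos _)

/-- `ω_{n,x}` is continuous. [cite: GORZPNAS2019, Thm. 7] -/
theorem continuous_xiGaussWeight (n : ℕ) (x : ℝ) : Continuous (xiGaussWeight n x) := by
  unfold xiGaussWeight
  exact ((continuous_deBruijnPhi.mul (continuous_pow n))).mul (Real.continuous_exp.comp (by fun_prop))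

/-- Domination: `|p(u)| · ω_{n,x}(u) ≤ C · e^{(x/2)u²}|Φ(u)|e^{u}` on `[0, ∞)` whenever `|p(u)| uⁿ ≤ C eᵘ`
there (non-Prop plumbing for the integrability lemmas). [folklore] -/
private theorem norm_mul_xiGaussWeight_le (n : ℕ) (x : ℝ) {p : ℝ → ℝ} {C : ℝ}
    (hp : ∀ u, 0 ≤ u → |p u| * u ^ n ≤ C * Real.exp u) {u : ℝ} (hu : 0 ≤ u) :
    ‖p u * xiGaussWeight n x u‖ ≤ C * deBruijnHBound (x / 2) 1 u := by
  rw [Real.norm_eq_abs, xiGaussWeight, deBruijnHBound, abs_mul, abs_mul, abs_mul,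
    abs_of_nonneg (pow_nonneg hu n), abs_of_pos (Real.exp_pos _), one_mul,
    show x / 2 * u ^ 2 = x * u ^ 2 / 2 by ring]
  have hΦ := abs_nonneg (deBruijnPhi u)
  have he := (Real.exp_pos (x * u ^ 2 / 2)).le
  calc |p u| * (|deBruijnPhi u| * u ^ n * Real.exp (x * u ^ 2 / 2))
      = (|p u| * u ^ n) * (|deBruijnPhi u| * Real.exp (x * u ^ 2 / 2)) := by ring
    _ ≤ (C * Real.exp u) * (|deBruijnPhi u| * Real.exp (x * u ^ 2 / 2)) :=
        mul_le_mul_of_nonneg_right (hp u hu) (mul_nonneg hΦ he)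
    _ = C * (Real.exp (x * u ^ 2 / 2) * |deBruijnPhi u| * Real.exp u) := by ring

/-- **Integrability of `p · ω_{n,x}` on `(0, ∞)`** for any continuous `p` with `|p(u)| uⁿ ≤ C eᵘ` on
`[0, ∞)` (super-exponential decay of `Φ`; via the tree's `integrableOn_deBruijnHBound`). [folklore] -/
private theorem integrableOn_mul_xiGaussWeight (n : ℕ) (x : ℝ) {p : ℝ → ℝ} (hpc : Continuous p)
    {C : ℝ} (hp : ∀ u, 0 ≤ u → |p u| * u ^ n ≤ C * Real.exp u) :
    IntegrableOn (fun u => p u * xiGaussWeight n x u) (Ioi 0) :=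
  ((integrableOn_deBruijnHBound (x / 2) 1).const_mul C).mono'
    ((hpc.mul (continuous_xiGaussWeight n x)).aestronglyMeasurable.restrict)
    (ae_restrict_of_forall_mem measurableSet_Ioi fun _ hu =>
      norm_mul_xiGaussWeight_le n x hp (le_of_lt hu))

/-- `uᵏ · uⁿ ≤ (k+n)! eᵘ` on `[0, ∞)` (non-Prop plumbing). [folklore] -/
private theorem pow_mul_pow_le_factorial_exp (k n : ℕ) {u : ℝ} (hu : 0 ≤ u) :
    |u ^ k| * u ^ n ≤ ((k + n) ! : ℝ) * Real.exp u := by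
  rw [abs_of_nonneg (pow_nonneg hu k), ← pow_add]
  exact pow_le_factorial_mul_exp hu (k + n)

/-- **`uᵏ ω_{n,x}(u)` is integrable on `(0, ∞)`** for every `k`. [cite: GORZPNAS2019, Thm. 7] -/
theorem integrableOn_pow_mul_xiGaussWeight (k n : ℕ) (x : ℝ) :
    IntegrableOn (fun u => u ^ k * xiGaussWeight n x u) (Ioi 0) :=
  integrableOn_mul_xiGaussWeight n x (continuous_pow k) fun _ hu => pow_mul_pow_le_factorial_exp k n hu

/-- **`ω_{n,x}` is integrable on `(0, ∞)`.** [cite: GORZPNAS2019, Thm. 7] -/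
theorem integrableOn_xiGaussWeight (n : ℕ) (x : ℝ) : IntegrableOn (xiGaussWeight n x) (Ioi 0) := by
  have h := integrableOn_pow_mul_xiGaussWeight 0 n x
  simpa using h

/-- `(u - a)² ω_{n,x}(u)` is integrable on `(0, ∞)`. [cite: GORZPNAS2019, Thm. 7] -/
theorem integrableOn_sq_sub_mul_xiGaussWeight (n : ℕ) (x a : ℝ) :
    IntegrableOn (fun u => (u - a) ^ 2 * xiGaussWeight n x u) (Ioi 0) := by
  have h2 := integrableOn_pow_mul_xiGaussWeight 2 n x
  have h1 := integrableOn_pow_mul_xiGaussWeight 1 n x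
  have h0 := integrableOn_xiGaussWeight n x
  have e : (fun u => (u - a) ^ 2 * xiGaussWeight n x u) =
      fun u => u ^ 2 * xiGaussWeight n x u + (-(2 * a)) * (u ^ 1 * xiGaussWeight n x u)
        + a ^ 2 * xiGaussWeight n x u := by
    funext u; ring
  rw [e]
  exact (h2.add (h1.const_mul _)).add (h0.const_mul _)

/-- **`0 < ∫₀^∞ ω_{n,x}`.** [cite: GORZPNAS2019, Thm. 7] -/
theorem integral_xiGaussWeight_pos (n : ℕ) (x : ℝ) : 0 < ∫ u in Ioi 0, xiGaussWeight n x u := by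
  rw [setIntegral_pos_iff_support_of_nonneg_ae
    (ae_restrict_of_forall_mem measurableSet_Ioi fun u hu => (xiGaussWeight_pos n x hu).le)
    (integrableOn_xiGaussWeight n x)]
  have hsub : Ioi (0 : ℝ) ⊆ (Function.support (xiGaussWeight n x)) ∩ Ioi 0 :=
    fun u hu => ⟨(xiGaussWeight_pos n x hu).ne', hu⟩
  exact lt_of_lt_of_le (by simp) (measure_mono hsub)

/-- A bounded continuous factor keeps `ω_{n,x}` integrable: if `|g| ≤ B` on `(0, ∞)` and `g` is
continuous on `(0, ∞)`, then `g · ω_{n,x}` is integrable there. [cite: GORZPNAS2019, Thm. 7] -/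
theorem integrableOn_bdd_mul_xiGaussWeight (n : ℕ) (x : ℝ) {g : ℝ → ℝ} (hg : ContinuousOn g (Ioi 0))
    {B : ℝ} (hB : ∀ u, 0 < u → |g u| ≤ B) :
    IntegrableOn (fun u => g u * xiGaussWeight n x u) (Ioi 0) := by
  refine ((integrableOn_xiGaussWeight n x).const_mul B).mono'
    ((hg.mul (continuous_xiGaussWeight n x).continuousOn).aestronglyMeasurable measurableSet_Ioi)
    (ae_restrict_of_forall_mem measurableSet_Ioi fun u hu => ?_)
  rw [Real.norm_eq_abs, abs_mul, abs_of_pos (xiGaussWeight_pos n x hu)]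
  exact mul_le_mul_of_nonneg_right (hB u hu) (xiGaussWeight_pos n x hu).le

variable (n : ℕ)

/-! ### The mode parametrisation and the potential -/

/-- `y(a) := a·L(a) - n` (`L = -Φ′/Φ`): the value of `x a²` for which `a` is the mode of `ω_{n,x}`.
[cite: GORZPNAS2019, Thm. 7] -/
def xiGaussY (a : ℝ) : ℝ := a * phiNegLogDeriv a - n

/-- `x(a) := y(a)/a²`: the Gaussian tilt for which `a` is the mode of `ω_{n,x}`. [cite: GORZPNAS2019, Thm. 7] -/
def xiGaussX (a : ℝ) : ℝ := xiGaussY n a / a ^ 2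

/-- The potential `W(u) = W_n(u) - xu²/2 = -n log u - log Φ(u) - xu²/2` of `ω_{n,x}`.
[cite: GORZPNAS2019, Thm. 7] -/
def xiGaussPotential (x u : ℝ) : ℝ := xiPotential n u - x * u ^ 2 / 2

/-- `W′(u) = W_n′(u) - xu`. [cite: GORZPNAS2019, Thm. 7] -/
def xiGaussPotentialDeriv (x u : ℝ) : ℝ := xiPotentialDeriv n u - x * u

/-- `W″(u) = W_n″(u) - x = n/u² + V(u) - x`. [cite: GORZPNAS2019, Thm. 7] -/
def xiGaussPotentialDeriv₂ (x u : ℝ) : ℝ := xiPotentialDeriv₂ n u - x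

/-- `e^{-W(u)} = ω_{n,x}(u)` for `u > 0`. [cite: GORZPNAS2019, Thm. 7] -/
theorem exp_neg_xiGaussPotential (x : ℝ) {u : ℝ} (hu : 0 < u) :
    Real.exp (-xiGaussPotential n x u) = xiGaussWeight n x u := by
  rw [xiGaussPotential, neg_sub, sub_eq_add_neg, Real.exp_add, exp_neg_xiPotential_natCast n hu,
    xiGaussWeight]
  ring

/-- `W′`: `HasDerivAt W (W′ u) u` for `u ≠ 0`. [cite: GORZPNAS2019, Thm. 7] -/
theorem hasDerivAt_xiGaussPotential (x : ℝ) {u : ℝ} (hu : u ≠ 0) :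
    HasDerivAt (xiGaussPotential n x) (xiGaussPotentialDeriv n x u) u := by
  have h1 := hasDerivAt_xiPotential (n : ℝ) hu
  have h2 : HasDerivAt (fun t : ℝ => x * t ^ 2 / 2) (x * u) u := by
    have h := ((hasDerivAt_pow 2 u).const_mul x).div_const 2
    refine h.congr_deriv ?_
    push_cast; ring
  have h := h1.sub h2
  exact h

/-- `W″`: `HasDerivAt W′ (W″ u) u` for `u ≠ 0`. [cite: GORZPNAS2019, Thm. 7] -/
theorem hasDerivAt_xiGaussPotentialDeriv (x : ℝ) {u : ℝ} (hu : u ≠ 0) :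
    HasDerivAt (xiGaussPotentialDeriv n x) (xiGaussPotentialDeriv₂ n x u) u := by
  have h1 := hasDerivAt_xiPotentialDeriv (n : ℝ) hu
  have h2 : HasDerivAt (fun t : ℝ => x * t) x u := by
    simpa using (hasDerivAt_id u).const_mul x
  exact h1.sub h2

/-- `W″` is continuous on `(0, ∞)`. [cite: GORZPNAS2019, Thm. 7] -/
theorem continuousOn_xiGaussPotentialDeriv₂ (x : ℝ) :
    ContinuousOn (xiGaussPotentialDeriv₂ n x) (Ioi 0) :=
  ((continuousOn_xiPotentialDeriv₂ (n : ℝ)).mono fun _ hu => ne_of_gt hu).sub continuousOn_const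

/-- **`W″(u) > 16πe^{4u} + n/u² - x`** for `u > 0` (quantitative log-concavity of `Φ`).
[cite: CoffeyCsordas2013, Theorem 2.4 (proof)] -/
theorem xiGaussPotentialDeriv₂_gt (x : ℝ) {u : ℝ} (hu : 0 < u) :
    16 * π * Real.exp (4 * u) + n / u ^ 2 - x < xiGaussPotentialDeriv₂ n x u := by
  have h := xiPotentialDeriv₂_gt (n : ℝ) u
  rw [abs_of_pos hu] at h
  unfold xiGaussPotentialDeriv₂
  linarith

/-- **Mode equation**: with `x = x(a) = (aL(a) - n)/a²`, `W′(a) = 0`. [cite: GORZPNAS2019, Thm. 7] -/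
theorem xiGaussPotentialDeriv_mode {a : ℝ} (ha : 0 < a) :
    xiGaussPotentialDeriv n (xiGaussX n a) a = 0 := by
  unfold xiGaussPotentialDeriv xiGaussX xiGaussY xiPotentialDeriv
  field_simp
  ring

/-- `L(a) = (n + y(a))/a` (definition of `y`). [cite: GORZPNAS2019, Thm. 7] -/
theorem phiNegLogDeriv_eq_div {a : ℝ} (ha : 0 < a) :
    phiNegLogDeriv a = (n + xiGaussY n a) / a := by
  unfold xiGaussY; field_simp; ring

/-! ### Envelopes at the mode -/

/-- **Upper envelope at the mode**: `4(n + y)/a + 36 ≤ 16πe^{4a}` (from `L(a) ≤ 4πe^{4a} - 9`).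
[cite: CoffeyCsordas2013, Proposition 2.1] -/
theorem xiGauss_floor_at_mode {a : ℝ} (ha : 0 < a) :
    4 * (n + xiGaussY n a) / a + 36 ≤ 16 * π * Real.exp (4 * a) := by
  have h := neg_deBruijnPhiDeriv_div_le ha.le
  have hL : phiNegLogDeriv a = (n + xiGaussY n a) / a := phiNegLogDeriv_eq_div n ha
  rw [phiNegLogDeriv] at hL
  rw [hL] at h
  have e : 4 * (n + xiGaussY n a) / a = 4 * ((n + xiGaussY n a) / a) := by ring
  rw [e]
  linarith

/-- **Lower envelope at the mode** (`a ≥ 3/2`): `16πe^{4a} ≤ 4(n + y)/a + 36.02`.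
[cite: CoffeyCsordas2013, Proposition 2.1] -/
theorem xiGauss_ceiling_at_mode {a : ℝ} (ha : 3 / 2 ≤ a) :
    16 * π * Real.exp (4 * a) ≤ 4 * (n + xiGaussY n a) / a + 9005 / 250 := by
  have ha0 : 0 < a := lt_of_lt_of_le (by norm_num) ha
  have h := le_neg_deBruijnPhiDeriv_div ha
  have hL : phiNegLogDeriv a = (n + xiGaussY n a) / a := phiNegLogDeriv_eq_div n ha0
  rw [phiNegLogDeriv] at hL
  rw [hL] at h
  have e : 4 * (n + xiGaussY n a) / a = 4 * ((n + xiGaussY n a) / a) := by ring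
  rw [e]
  norm_num at h ⊢
  linarith

end Literature.NumberTheory.LFunctions
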